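import Literature.NumberTheory.Sieve.LinearEquationsInPrimesGowersCyclic
import Literature.NumberTheory.Sieve.LinearEquationsInPrimesFourierU2
import HarnessLib

/-!
# Route `GreenTaoLevelTwo`, crux `GITwo` (stmt-Parity-21275), line `birth`, stub `stub_cyclicInverse`:
# Gowers' argument, step 1 — a large `U³(ℤ/Mℤ)` norm gives many derivatives with a large Fourier coefficient

The one remaining registered stub of the crux `GITwo` is `stub_cyclicInverse`, the inverse theorem
for the `U³(ℤ/N'ℤ)` norm (B. Green, T. Tao, *An inverse theorem for the Gowers `U³(G)` norm*,
Proc. Edinb. Math. Soc. 51 (2008), Thm. 12.8; the argument of W. T. Gowers, *A new proof of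
Szemerédi's theorem for progressions of length four*, GAFA 8 (1998)).  Its printed proof opens
(GT08a §5, Prop. 5.4, first half; Gowers 1998 §§2–3) with the passage from the hypothesis
`‖f‖_{U³} ≥ η` to LINEAR Fourier information on the multiplicative derivatives
`Δ_t f (y) = f(y) f(y + t)` (real-valued `f`): for at least `η^{O(1)} M` shifts `t` the derivative
`Δ_t f` has a Fourier coefficient of size `η^{O(1)}`.  This def-free helper file lands exactly that
step over `ℤ/Mℤ`, in the tree's vocabulary (`gowersPower`, `gowersProd` of
`LinearEquationsInPrimesGowersCyclic.lean`; `dftCoeff` of `LinearEquationsInPrimesFourierU2.lean`),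
with explicit constants:

* `gowersProd_mul_shift`, `gowersPower_succ_eq_expect` — the inductive formula
  `‖g‖_{U^{k+1}}^{2^{k+1}} = 𝔼_t ‖Δ_t g‖_{U^k}^{2^k}` (GT08a (1.4) / GT2010 App. B);
* `gowersPower_le_one`, `abs_mul_shift_le_one` — `1`-boundedness bookkeeping;
* `card_filter_ge_of_expect_ge` — the Markov step: `𝔼 a ≥ ε`, `a ≤ 1` ⇒ `#{a ≥ ε/2} ≥ εM/2`;
* `exists_dftCoeff_sq_ge` — the `U²` inverse theorem in the non-strict form
  `‖g‖_{U²}^4 ≥ γ`, `|g| ≤ 1` ⇒ `∃ ξ, |ĝ(ξ)|² ≥ γ` (tree: `gowersPower_two_le_of_dft`);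
* `card_shifts_large_dft_ge`, `exists_shifts_freq_of_gowersPower_three` — **GT08a Prop. 5.4, first
  half**: if `|f| ≤ 1` and `‖f‖_{U³(ℤ/Mℤ)}^8 ≥ ε` then there are a set `H ⊆ ℤ/Mℤ` with
  `#H ≥ εM/2` and frequencies `ξ : ℤ/Mℤ → ℤ/Mℤ` with `|(Δ_t f)^(ξ_t)|² ≥ ε/2` for every `t ∈ H`.

Not here (next files of the same section): the second half of Prop. 5.4 (the graph
`{(t, ξ_t) : t ∈ H}` has `≥ ε^{O(1)} M³` additive quadruples, two further Cauchy–Schwarz steps),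
then §§6–10 (Balog–Szemerédi–Gowers, Bogolyubov/Bohr sets, linearisation, the symmetry argument,
local quadratic phases) and §12 (nilsequence formulation over the Heisenberg class).

References: [GreenTao2008U3Inverse] B. Green, T. Tao, PEMS 51 (2008) 73–153, §5, Prop. 5.4
(arXiv:math/0503014); W. T. Gowers, GAFA 8 (1998) 529–551, Lemmas 2–3; [GreenTao2010] App. B.
-/

noncomputable section

open Finset
open scoped BigOperators

namespace Summit.Parity.GeneralizedHardyLittlewood.GreenTaoLevelTwoGITwoCyclicInverse

open Literature.NumberTheory.Sieve

variable {M : ℕ}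

/-- The Gowers cube product of the multiplicative derivative `Δ_t g (y) = g(y) g(y+t)` splits as
the cube product of `g` at `x` times the cube product of `g` at `x + t`.
[cite: GreenTao2008U3Inverse, §1 (1.4) and §5] -/
theorem gowersProd_mul_shift (k : ℕ) (g : ZMod M → ℝ) (t x : ZMod M) (h : Fin k → ZMod M) :
    gowersProd k (fun y => g y * g (y + t)) x h = gowersProd k g x h * gowersProd k g (x + t) h := by
  unfold gowersProd
  rw [← Finset.prod_mul_distrib]
  exact Finset.prod_congr rfl fun ω _ => by rw [add_right_comm]

/-- A product of two values of a `1`-bounded function is `1`-bounded: `|g(x) g(x+t)| ≤ 1`. [folklore] -/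
theorem abs_mul_shift_le_one {g : ZMod M → ℝ} (hg : ∀ x, |g x| ≤ 1) (t x : ZMod M) :
    |g x * g (x + t)| ≤ 1 := by
  rw [abs_mul]
  exact mul_le_one₀ (hg x) (abs_nonneg _) (hg _)

variable [NeZero M]

/-- **The inductive formula for the Gowers norms** on `ℤ/Mℤ` (real-valued functions):
`‖g‖_{U^{k+1}}^{2^{k+1}} = 𝔼_{t ∈ ℤ/Mℤ} ‖Δ_t g‖_{U^k}^{2^k}` with `Δ_t g (y) = g(y) g(y + t)`.
[cite: GreenTao2008U3Inverse, §1 (1.4)] -/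
theorem gowersPower_succ_eq_expect (k : ℕ) (g : ZMod M → ℝ) :
    gowersPower (k + 1) g = 𝔼 t : ZMod M, gowersPower k (fun y => g y * g (y + t)) := by
  have hx : ∀ x : ZMod M, (𝔼 h : Fin (k + 1) → ZMod M, gowersProd (k + 1) g x h) =
      𝔼 t : ZMod M, 𝔼 h' : Fin k → ZMod M, gowersProd k g x h' * gowersProd k g (x + t) h' := by
    intro x
    rw [← expect_comp_equiv (Fin.snocEquiv fun _ => ZMod M)]
    show (𝔼 q : ZMod M × (Fin k → ZMod M), gowersProd (k + 1) g x (Fin.snoc q.2 q.1)) = _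
    simp_rw [gowersProd_succ]
    exact expect_prod_eq _
  unfold gowersPower
  rw [expect_prod_eq]
  simp_rw [hx]
  rw [Finset.expect_comm]
  refine Finset.expect_congr rfl fun t _ => ?_
  rw [expect_prod_eq]
  simp_rw [gowersProd_mul_shift]

/-- The Gowers average of a `1`-bounded function is at most `1`. [folklore] -/
theorem gowersPower_le_one (k : ℕ) {g : ZMod M → ℝ} (hg : ∀ x, |g x| ≤ 1) : gowersPower k g ≤ 1 := by
  unfold gowersPower
  have h1 : ∀ p : ZMod M × (Fin k → ZMod M), gowersProd k g p.1 p.2 ≤ 1 := by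
    intro p
    unfold gowersProd
    refine (le_abs_self _).trans ?_
    rw [Finset.abs_prod]
    exact Finset.prod_le_one (fun _ _ => abs_nonneg _) fun _ _ => hg _
  calc (𝔼 p : ZMod M × (Fin k → ZMod M), gowersProd k g p.1 p.2)
      ≤ 𝔼 _p : ZMod M × (Fin k → ZMod M), (1 : ℝ) := Finset.expect_le_expect fun p _ => h1 p
    _ = 1 := Finset.expect_const Finset.univ_nonempty _

/-- **Markov step.** If `a ≤ 1` pointwise on `ℤ/Mℤ` and `𝔼_t a(t) ≥ ε`, then `a(t) ≥ ε/2` for at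
least `εM/2` values of `t`. [folklore] -/
theorem card_filter_ge_of_expect_ge {a : ZMod M → ℝ} (ha1 : ∀ t, a t ≤ 1) {ε : ℝ}
    (hε : ε ≤ 𝔼 t : ZMod M, a t) (S : Finset (ZMod M)) (hS : ∀ t, ε / 2 ≤ a t → t ∈ S) :
    ε / 2 * M ≤ #S := by
  have hMpos : (0 : ℝ) < M := by exact_mod_cast Nat.pos_of_ne_zero (NeZero.ne M)
  rcases lt_or_ge ε 0 with hneg | hpos
  · have : ε / 2 * M ≤ 0 := mul_nonpos_of_nonpos_of_nonneg (by linarith) hMpos.le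
    exact this.trans (Nat.cast_nonneg _)
  have hsum : ε * M ≤ ∑ t : ZMod M, a t := by
    rw [Fintype.expect_eq_sum_div_card, ZMod.card, le_div_iff₀ hMpos] at hε
    exact hε
  classical
  have hsplit : ∑ t : ZMod M, a t =
      ∑ t ∈ univ.filter (fun t => t ∈ S), a t + ∑ t ∈ univ.filter (fun t => ¬ t ∈ S), a t :=
    (Finset.sum_filter_add_sum_filter_not univ (fun t => t ∈ S) a).symm
  have hS' : univ.filter (fun t : ZMod M => t ∈ S) = S := by
    ext t; simp
  have h1 : ∑ t ∈ S, a t ≤ #S :=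
    calc ∑ t ∈ S, a t ≤ ∑ _t ∈ S, (1 : ℝ) := sum_le_sum fun t _ => ha1 t
      _ = #S := by rw [sum_const, nsmul_eq_mul, mul_one]
  have h2 : ∑ t ∈ univ.filter (fun t => ¬ t ∈ S), a t ≤
      #(univ.filter (fun t : ZMod M => ¬ t ∈ S)) * (ε / 2) :=
    calc ∑ t ∈ univ.filter (fun t => ¬ t ∈ S), a t
        ≤ ∑ _t ∈ univ.filter (fun t => ¬ t ∈ S), ε / 2 := sum_le_sum fun t ht => by
            have hnot : ¬ t ∈ S := (mem_filter.mp ht).2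
            by_contra hlt
            exact hnot (hS t (not_lt.mp fun h => hlt h.le))
      _ = _ := by rw [sum_const, nsmul_eq_mul]
  have h3 : (#(univ.filter (fun t : ZMod M => ¬ t ∈ S)) : ℝ) ≤ M := by
    have := card_filter_le (univ : Finset (ZMod M)) (fun t => ¬ t ∈ S)
    rw [card_univ, ZMod.card] at this
    exact_mod_cast this
  rw [hsplit, hS'] at hsum
  nlinarith

/-- **The `U²` inverse theorem, non-strict form**: a `1`-bounded `g : ℤ/Mℤ → ℝ` with
`‖g‖_{U²}^4 ≥ γ` has a Fourier coefficient with `|ĝ(ξ)|² ≥ γ` (from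
`‖g‖_{U²}^4 ≤ sup_ξ |ĝ(ξ)|² · 𝔼 g²`; no sign condition on `γ` is needed). [cite: GreenTao2008U3Inverse, §5, proof of Prop. 5.4] -/
theorem exists_dftCoeff_sq_ge {g : ZMod M → ℝ} (hg : ∀ x, |g x| ≤ 1) {γ : ℝ}
    (h : γ ≤ gowersPower 2 g) : ∃ ξ : ZMod M, γ ≤ ‖dftCoeff g ξ‖ ^ 2 := by
  by_contra hall
  push Not at hall
  obtain ⟨ξ₀, -, hmax⟩ :=
    Finset.exists_max_image univ (fun ξ : ZMod M => ‖dftCoeff g ξ‖) univ_nonempty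
  have h1 := gowersPower_two_le_of_dft g (δ := ‖dftCoeff g ξ₀‖) fun ξ => hmax ξ (mem_univ ξ)
  have h2 : (∑ x : ZMod M, g x ^ 2) / M ≤ 1 := by
    rw [div_le_one (by exact_mod_cast Nat.pos_of_ne_zero (NeZero.ne M))]
    calc ∑ x : ZMod M, g x ^ 2 ≤ ∑ _x : ZMod M, (1 : ℝ) := Finset.sum_le_sum fun x _ => by
          rw [← sq_abs]; exact pow_le_one₀ (abs_nonneg _) (hg x)
      _ = M := by rw [Finset.sum_const, Finset.card_univ, ZMod.card, nsmul_eq_mul, mul_one]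
  have h3 : gowersPower 2 g ≤ ‖dftCoeff g ξ₀‖ ^ 2 :=
    h1.trans (mul_le_of_le_one_right (sq_nonneg _) h2)
  linarith [hall ξ₀]

/-- **Gowers' argument, step 1 (counting form).** If `|f| ≤ 1` on `ℤ/Mℤ` and
`‖f‖_{U³}^8 ≥ ε`, then for at least `εM/2` shifts `t` the derivative `Δ_t f (y) = f(y)f(y+t)`
has a Fourier coefficient with `|(Δ_t f)^(ξ)|² ≥ ε/2`: every finset `S` containing all such
shifts has `#S ≥ εM/2`. [cite: GreenTao2008U3Inverse, Prop. 5.4 (first half)] -/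
theorem card_shifts_large_dft_ge {f : ZMod M → ℝ} (hf : ∀ x, |f x| ≤ 1) {ε : ℝ}
    (hε : ε ≤ gowersPower 3 f) (S : Finset (ZMod M))
    (hS : ∀ t, (∃ ξ : ZMod M, ε / 2 ≤ ‖dftCoeff (fun y => f y * f (y + t)) ξ‖ ^ 2) → t ∈ S) :
    ε / 2 * M ≤ #S := by
  have h3 : gowersPower 3 f = 𝔼 t : ZMod M, gowersPower 2 (fun y => f y * f (y + t)) :=
    gowersPower_succ_eq_expect 2 f
  refine card_filter_ge_of_expect_ge (a := fun t => gowersPower 2 (fun y => f y * f (y + t)))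
    (fun t => gowersPower_le_one 2 (abs_mul_shift_le_one hf t)) (hε.trans h3.le) S fun t ht => ?_
  exact hS t (exists_dftCoeff_sq_ge (abs_mul_shift_le_one hf t) ht)

/-- **Gowers' argument, step 1 (GT08a Prop. 5.4, first half).** If `|f| ≤ 1` on `ℤ/Mℤ` and
`‖f‖_{U³}^8 ≥ ε`, there are a set of shifts `H` with `#H ≥ εM/2` and frequencies
`ξ : ℤ/Mℤ → ℤ/Mℤ` such that `|(Δ_t f)^(ξ_t)|² ≥ ε/2` for every `t ∈ H`.
[cite: GreenTao2008U3Inverse, Prop. 5.4 (first half)] -/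
theorem exists_shifts_freq_of_gowersPower_three {f : ZMod M → ℝ} (hf : ∀ x, |f x| ≤ 1) {ε : ℝ}
    (hε : ε ≤ gowersPower 3 f) :
    ∃ (H : Finset (ZMod M)) (ξ : ZMod M → ZMod M), ε / 2 * M ≤ #H ∧
      ∀ t ∈ H, ε / 2 ≤ ‖dftCoeff (fun y => f y * f (y + t)) (ξ t)‖ ^ 2 := by
  classical
  let P : ZMod M → Prop := fun t => ∃ ξ : ZMod M, ε / 2 ≤ ‖dftCoeff (fun y => f y * f (y + t)) ξ‖ ^ 2
  refine ⟨univ.filter P, fun t => if h : P t then h.choose else 0,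
    card_shifts_large_dft_ge hf hε _ fun t ht => mem_filter.mpr ⟨mem_univ t, ht⟩,
    fun t ht => ?_⟩
  have hP : P t := (mem_filter.mp ht).2
  show ε / 2 ≤ ‖dftCoeff (fun y => f y * f (y + t)) (if h : P t then h.choose else 0)‖ ^ 2
  rw [dif_pos hP]
  exact hP.choose_spec

end Summit.Parity.GeneralizedHardyLittlewood.GreenTaoLevelTwoGITwoCyclicInverse
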